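import Summits.ABC.IUTFork.LDHSUnitFamilyField
import Literature.IUT.LogVolume.Corollary22PartIILemmas
import HarnessLib

/-!
# The S-unit quadratic family of the `λ`-line: II. Valuations — the pole divisor of `j(λ_{a,c})` is EXACTLY
# `2a·𝔭₁ + 2c·𝔮₁ + 2c·𝔮₂`

Record-only PROOF file (D-0012) of the abc-iut cell (R2 S-chain team, seat abc-iut-s2-p4 gen 4); TAKES NO SIDE on [IUTchIII]
Cor. 3.12 or [IUTchIV] Thm. 1.10. S. Mochizuki, *IUT IV* [Mochizuki2012], Cor. 2.2 (ii) proof (P2), (P5) pp. 45–46 ("`l` does not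
divide any nonzero `h_v`", `h_v = −ord_v(j)`; "`𝕍^bad_mod ≠ ∅`"); Dupuy–Hilado [DupuyHilado2025] §2.4.2 (`ord_v`), §3.3
(`ord_v(q_v) = −ord_v(j_E)`); Silverman AEC III.1.7 (`j(λ) = 2⁸(λ²−λ+1)³/(λ²(λ−1)²)`).

For the family of part I (`θθ' = 5^a7^c`, `θ + θ' = s = 2·7^c + 5^a`, `λ = θ/7^c`, places `𝔭₁ ∋ θ ∌ 𝔭₂` over `5`, `𝔮₁ ∋ θ ∌ 𝔮₂`
over `7`) this file computes, in the kernel, `ord_v j(λ)` at EVERY finite place `v` of `F`: with `N₁ := θ − 7^c`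
(`N₁·N₁' = −7^{2c}`) and `N₂ := θ² − 7^cθ + 7^{2c} = θ·N₁ + 7^{2c}` one has `j(λ) = 2⁸N₂³/(θ²N₁²7^{2c})`, and
* `ord_{𝔭₁} j(λ) = −2a` (`ord θ = a`, `N₁, N₂` units), `ord_{𝔭₂} j(λ) ≥ 0` (the GOOD place: `5` is MIXED);
* `ord_{𝔮₁} j(λ) = −2c` (`ord θ = c`, `ord N₁ = 2c`, `ord N₂ = 2c`), `ord_{𝔮₂} j(λ) = −2c` (`θ, N₁, N₂` units, `ord 7 = 1`);
* `ord_v j(λ) ≥ 0` at every place dividing neither `5` nor `7`.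
So (P2) at a prime `l` is the congruence `l ∤ 2a ∧ l ∤ 2c` — certifiable WITHOUT factoring, at unbounded height. Also `ord_{𝔭₁} λ = a > 0 =
ord_{𝔭₂} λ` (irrationality of `λ` and of `j(λ)` by the split valuations, part III). Elementary valuation arithmetic over part I;
nothing asserted about Θ-data; no side taken. [cite: Mochizuki2012, IUTchIV Cor 2.2 (ii) proof (P2) (P5) pp.45-46]
[cite: DupuyHilado2025, §2.4.2, §3.3] [claim: Mochizuki2012, status: disputed] for the IUT locators only.
-/

noncomputable section

namespace Summit.ABC.IUTFork.SUnitFamily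

open NumberField IsDedekindDomain Literature.IUT.LogVolume Literature.IUT.LogVolume.Cor22
open Literature.NumberTheory.DiophantineGeometry.GenEll

section Generic

variable {a c : ℕ} (v : HeightOneSpectrum (𝓞 (F a c)))

/-- An algebraic integer outside `v` is non-zero in `F`. [folklore] -/
theorem coe_ne_zero_of_not_mem {x : 𝓞 (F a c)} (hx : x ∉ v.asIdeal) : (x : F a c) ≠ 0 := by
  intro h
  apply hx
  rw [(RingOfIntegers.coe_eq_zero_iff).mp h]
  exact v.asIdeal.zero_mem

/-- `ord_v(x/y) = ord_v x − ord_v y`. [cite: DupuyHilado2025, §2.4.2] -/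
theorem ord_div' {x y : F a c} (hx : x ≠ 0) (hy : y ≠ 0) :
    ord (F a c) v (x / y) = ord (F a c) v x - ord (F a c) v y := by
  rw [div_eq_mul_inv, ord_mul (F a c) v hx (inv_ne_zero hy), ord_inv, sub_eq_add_neg]

/-- An algebraic integer with `ord_v ≥ n` lies in `v^n`. [cite: DupuyHilado2025, §2.4.2] -/
theorem mem_pow_of_le_ord {y : 𝓞 (F a c)} (hy0 : y ≠ 0) {n : ℕ} (h : (n : ℤ) ≤ ord (F a c) v (y : F a c)) :
    y ∈ v.asIdeal ^ n := by
  rw [← HeightOneSpectrum.intValuation_le_pow_iff_mem]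
  have hne : v.intValuation y ≠ 0 := v.intValuation_ne_zero y hy0
  rw [← WithZero.log_le_log hne WithZero.exp_ne_zero, WithZero.log_exp]
  unfold ord at h
  rw [show ((y : 𝓞 (F a c)) : F a c) = algebraMap (𝓞 (F a c)) (F a c) y from rfl,
    HeightOneSpectrum.valuation_of_algebraMap] at h
  omega

/-- Coercion of a natural number from `𝓞 F` to `F`. [folklore] -/
theorem coe_natCast' (n : ℕ) : (((n : ℕ) : 𝓞 (F a c)) : F a c) = n := map_natCast _ n

/-- `ord_v(n) ≥ 0` for a natural number. [cite: DupuyHilado2025, §2.4.2] -/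
theorem ord_natCast_nonneg (n : ℕ) : 0 ≤ ord (F a c) v (n : F a c) := by
  rw [← coe_natCast']; exact ord_nonneg_of_isIntegral (F a c) v _

/-- `ord_v(n) = 0` if `n ∉ v`. [cite: DupuyHilado2025, §2.4.2] -/
theorem ord_natCast_eq_zero_of_not_mem {n : ℕ} (hn : ((n : ℕ) : 𝓞 (F a c)) ∉ v.asIdeal) :
    ord (F a c) v (n : F a c) = 0 := by
  rw [← coe_natCast']; exact SplitDepth.ord_coe_eq_zero_of_not_mem v hn

end Generic

/-! ## The integers `θ, θ', N₁ = θ − 7^c, N₂ = θ² − 7^cθ + 7^{2c}` -/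

section Integers

variable (a c : ℕ)

/-- `θ ≠ 0` and `θ' ≠ 0` (their product is `5^a7^c ≠ 0`). [folklore] -/
theorem θ_ne_zero : θ a c ≠ 0 ∧ θ' a c ≠ 0 := by
  have h := θ_mul_θ' a c
  have hne : ((5 ^ a * 7 ^ c : ℕ) : F a c) ≠ 0 := by exact_mod_cast (by positivity : 5 ^ a * 7 ^ c ≠ 0)
  rw [← h] at hne
  exact ⟨left_ne_zero_of_mul hne, right_ne_zero_of_mul hne⟩

/-- `(θ − 7^c)(θ' − 7^c) = −7^{2c}` in `F`. [folklore] -/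
theorem N₁_mul_N₁'_F : (θ a c - (7 : F a c) ^ c) * (θ' a c - (7 : F a c) ^ c) = -(7 : F a c) ^ (2 * c) := by
  have h1 := θ_mul_θ' a c
  have h2 := θ_add_θ' a c
  unfold s at h2
  push_cast at h1 h2
  have : (θ a c - 7 ^ c) * (θ' a c - 7 ^ c) = θ a c * θ' a c - 7 ^ c * (θ a c + θ' a c) + (7 : F a c) ^ (2 * c) := by ring
  rw [this, h1, h2]; ring

/-- `N₁ ≠ 0`, `N₁' ≠ 0` in `F`. [folklore] -/
theorem N₁_ne_zero : θ a c - (7 : F a c) ^ c ≠ 0 ∧ θ' a c - (7 : F a c) ^ c ≠ 0 := by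
  have h := N₁_mul_N₁'_F a c
  have hne : -(7 : F a c) ^ (2 * c) ≠ 0 := neg_ne_zero.mpr (pow_ne_zero _ (by norm_num))
  rw [← h] at hne
  exact ⟨left_ne_zero_of_mul hne, right_ne_zero_of_mul hne⟩

/-- The integer `N₁ = θ − 7^c`. [folklore] -/
theorem coe_N₁ : ((θI a c - ((7 ^ c : ℕ) : 𝓞 (F a c)) : 𝓞 (F a c)) : F a c) = θ a c - (7 : F a c) ^ c := by
  rw [RingOfIntegers.coe_eq_algebraMap, map_sub, map_natCast, ← RingOfIntegers.coe_eq_algebraMap, coe_θI]; push_cast; rfl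

/-- The integer `N₁' = θ' − 7^c`. [folklore] -/
theorem coe_N₁' : ((θI' a c - ((7 ^ c : ℕ) : 𝓞 (F a c)) : 𝓞 (F a c)) : F a c) = θ' a c - (7 : F a c) ^ c := by
  rw [RingOfIntegers.coe_eq_algebraMap, map_sub, map_natCast, ← RingOfIntegers.coe_eq_algebraMap, coe_θI']; push_cast; rfl

/-- The integer `N₂ = θ² − 7^cθ + 7^{2c}`. [folklore] -/
theorem coe_N₂ : ((θI a c ^ 2 - ((7 ^ c : ℕ) : 𝓞 (F a c)) * θI a c + ((7 ^ (2 * c) : ℕ) : 𝓞 (F a c)) : 𝓞 (F a c)) : F a c) =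
    θ a c ^ 2 - (7 : F a c) ^ c * θ a c + (7 : F a c) ^ (2 * c) := by
  rw [RingOfIntegers.coe_eq_algebraMap, map_add, map_sub, map_mul, map_pow, map_natCast, map_natCast,
    ← RingOfIntegers.coe_eq_algebraMap, coe_θI]; push_cast; rfl

/-- `(θ − 7^c)(θ' − 7^c) = −7^{2c}` in `𝓞 F`. [folklore] -/
theorem N₁_mul_N₁' : (θI a c - ((7 ^ c : ℕ) : 𝓞 (F a c))) * (θI' a c - ((7 ^ c : ℕ) : 𝓞 (F a c))) =
    -(((7 : ℕ) : 𝓞 (F a c)) ^ (2 * c)) := by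
  apply RingOfIntegers.coe_injective
  have h1 := coe_N₁ a c
  have h2 := coe_N₁' a c
  rw [map_mul, map_neg, map_pow, map_natCast]
  rw [RingOfIntegers.coe_eq_algebraMap] at h1 h2
  rw [h1, h2, N₁_mul_N₁'_F]
  push_cast; ring

/-- `N₂ = θ·N₁ + 7^{2c}`. [folklore] -/
theorem N₂_eq : (θI a c ^ 2 - ((7 ^ c : ℕ) : 𝓞 (F a c)) * θI a c + ((7 ^ (2 * c) : ℕ) : 𝓞 (F a c))) =
    θI a c * (θI a c - ((7 ^ c : ℕ) : 𝓞 (F a c))) + ((7 : ℕ) : 𝓞 (F a c)) ^ (2 * c) := by push_cast; ring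

/-- `j(λ) = 2⁸·N₂³/(θ²·N₁²·7^{2c})` in `F`. [folklore] -/
theorem jInv_lam_eq : jInv (lam a c) =
    (2 : F a c) ^ 8 * (θ a c ^ 2 - (7 : F a c) ^ c * θ a c + (7 : F a c) ^ (2 * c)) ^ 3 /
      (θ a c ^ 2 * (θ a c - (7 : F a c) ^ c) ^ 2 * (7 : F a c) ^ (2 * c)) := by
  have h7 : (7 : F a c) ^ c ≠ 0 := pow_ne_zero _ (by norm_num)
  have hθ := (θ_ne_zero a c).1
  have hN := (N₁_ne_zero a c).1
  unfold jInv lam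
  have h2c : (7 : F a c) ^ (2 * c) = ((7 : F a c) ^ c) ^ 2 := by rw [mul_comm, pow_mul]
  rw [h2c]
  field_simp

end Integers

/-! ## Valuations of `θ, N₁, N₂` -/

section Ord

variable {a c : ℕ} {v : HeightOneSpectrum (𝓞 (F a c))}

/-- `ord_v θ + ord_v θ' = a·ord_v 5 + c·ord_v 7`. [cite: DupuyHilado2025, §2.4.2] -/
theorem ord_θ_add (v : HeightOneSpectrum (𝓞 (F a c))) :
    ord (F a c) v (θ a c) + ord (F a c) v (θ' a c) = a * ord (F a c) v (5 : F a c) + c * ord (F a c) v (7 : F a c) := by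
  have h50 : (5 : F a c) ≠ 0 := by exact_mod_cast (show (5 : ℕ) ≠ 0 by norm_num)
  have h70 : (7 : F a c) ≠ 0 := by exact_mod_cast (show (7 : ℕ) ≠ 0 by norm_num)
  have h5 : (5 : F a c) ^ a ≠ 0 := pow_ne_zero _ h50
  have h7 : (7 : F a c) ^ c ≠ 0 := pow_ne_zero _ h70
  have hprod : θ a c * θ' a c = (5 : F a c) ^ a * (7 : F a c) ^ c := by rw [θ_mul_θ']; push_cast; rfl
  have h1 := ord_mul (F a c) v (θ_ne_zero a c).1 (θ_ne_zero a c).2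
  rw [hprod, ord_mul (F a c) v h5 h7, ord_pow, ord_pow] at h1
  omega

/-- At a place `v ∌ θ'`: `ord_v θ = a·ord_v 5 + c·ord_v 7`. [cite: DupuyHilado2025, §2.4.2] -/
theorem ord_θ_of_not_mem (hθ' : θI' a c ∉ v.asIdeal) :
    ord (F a c) v (θ a c) = a * ord (F a c) v (5 : F a c) + c * ord (F a c) v (7 : F a c) := by
  have h := ord_θ_add v
  have h0 := SplitDepth.ord_coe_eq_zero_of_not_mem v hθ'
  rw [coe_θI'] at h0
  omega

/-- At a place `v ∌ θ`: `ord_v θ = 0`. [cite: DupuyHilado2025, §2.4.2] -/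
theorem ord_θ_eq_zero (hθ : θI a c ∉ v.asIdeal) : ord (F a c) v (θ a c) = 0 := by
  have h := SplitDepth.ord_coe_eq_zero_of_not_mem v hθ
  rw [coe_θI] at h
  exact h

/-- `7^c ∈ v` when `7 ∈ v` and `c ≥ 1`; `7^{2c} ∈ v` likewise. [folklore] -/
theorem seven_pow_mem (h7 : ((7 : ℕ) : 𝓞 (F a c)) ∈ v.asIdeal) {m : ℕ} (hm : 1 ≤ m) :
    ((7 ^ m : ℕ) : 𝓞 (F a c)) ∈ v.asIdeal := by
  have := v.asIdeal.pow_mem_of_mem h7 m hm; push_cast at this ⊢; exact this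

/-- `N₁ = θ − 7^c ∉ v` when `7 ∉ v` (`N₁N₁' = −7^{2c}`). [folklore] -/
theorem N₁_not_mem (h7 : ((7 : ℕ) : 𝓞 (F a c)) ∉ v.asIdeal) : θI a c - ((7 ^ c : ℕ) : 𝓞 (F a c)) ∉ v.asIdeal := by
  intro h
  have hprod := v.asIdeal.mul_mem_right (θI' a c - ((7 ^ c : ℕ) : 𝓞 (F a c))) h
  rw [N₁_mul_N₁', neg_mem_iff] at hprod
  exact h7 (v.isPrime.mem_of_pow_mem _ hprod)

/-- `N₁ ∉ v` when `7 ∈ v ∌ θ` (`c ≥ 1`). [folklore] -/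
theorem N₁_not_mem' (h7 : ((7 : ℕ) : 𝓞 (F a c)) ∈ v.asIdeal) (hθ : θI a c ∉ v.asIdeal) (hc : 1 ≤ c) :
    θI a c - ((7 ^ c : ℕ) : 𝓞 (F a c)) ∉ v.asIdeal := by
  intro h
  apply hθ
  have := v.asIdeal.add_mem h (seven_pow_mem h7 hc)
  simpa using this

/-- `N₁' ∉ v` when `7 ∈ v ∌ θ'` (`c ≥ 1`). [folklore] -/
theorem N₁'_not_mem (h7 : ((7 : ℕ) : 𝓞 (F a c)) ∈ v.asIdeal) (hθ' : θI' a c ∉ v.asIdeal) (hc : 1 ≤ c) :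
    θI' a c - ((7 ^ c : ℕ) : 𝓞 (F a c)) ∉ v.asIdeal := by
  intro h
  apply hθ'
  have := v.asIdeal.add_mem h (seven_pow_mem h7 hc)
  simpa using this

/-- `ord_v N₁ = 0` when `N₁ ∉ v`. [cite: DupuyHilado2025, §2.4.2] -/
theorem ord_N₁_eq_zero (h : θI a c - ((7 ^ c : ℕ) : 𝓞 (F a c)) ∉ v.asIdeal) : ord (F a c) v (θ a c - (7 : F a c) ^ c) = 0 := by
  rw [← coe_N₁]; exact SplitDepth.ord_coe_eq_zero_of_not_mem v h

/-- At `𝔮₁` (`7 ∈ v`, `θ' ∉ v`, `ord_v 7 = 1`, `c ≥ 1`): `ord_v N₁ = 2c`. [cite: DupuyHilado2025, §2.4.2] -/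
theorem ord_N₁_eq (h7 : ((7 : ℕ) : 𝓞 (F a c)) ∈ v.asIdeal) (hθ' : θI' a c ∉ v.asIdeal) (ho7 : ord (F a c) v (7 : F a c) = 1)
    (hc : 1 ≤ c) : ord (F a c) v (θ a c - (7 : F a c) ^ c) = 2 * c := by
  have h0 : ord (F a c) v (θ' a c - (7 : F a c) ^ c) = 0 := by
    rw [← coe_N₁']; exact SplitDepth.ord_coe_eq_zero_of_not_mem v (N₁'_not_mem h7 hθ' hc)
  have hprod : ord (F a c) v ((θ a c - (7 : F a c) ^ c) * (θ' a c - (7 : F a c) ^ c)) = 2 * c := by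
    rw [N₁_mul_N₁'_F, show -(7 : F a c) ^ (2 * c) = (-1) * (7 : F a c) ^ (2 * c) by ring,
      ord_mul (F a c) v (by norm_num) (pow_ne_zero _ (by norm_num)), ord_pow, ho7]
    have : ord (F a c) v (-1 : F a c) = 0 := by
      rw [show (-1 : F a c) = (1 : F a c)⁻¹ * (-1) * 1 by ring]
      have h := ord_one (F a c) v
      have hn : ord (F a c) v ((-1 : F a c) * (-1)) = ord (F a c) v (-1 : F a c) + ord (F a c) v (-1 : F a c) :=
        ord_mul (F a c) v (by norm_num) (by norm_num)
      rw [show (-1 : F a c) * (-1) = 1 by ring, h] at hn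
      simp only [inv_one, one_mul, mul_one]
      omega
    rw [this]; push_cast; ring
  rw [ord_mul (F a c) v (N₁_ne_zero a c).1 (N₁_ne_zero a c).2, h0] at hprod
  omega

/-- `N₂ ∉ v` when `θ ∈ v ∌ 7`. [folklore] -/
theorem N₂_not_mem_of_mem (hθ : θI a c ∈ v.asIdeal) (h7 : ((7 : ℕ) : 𝓞 (F a c)) ∉ v.asIdeal) :
    θI a c ^ 2 - ((7 ^ c : ℕ) : 𝓞 (F a c)) * θI a c + ((7 ^ (2 * c) : ℕ) : 𝓞 (F a c)) ∉ v.asIdeal := by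
  rw [N₂_eq]
  intro h
  have h1 : θI a c * (θI a c - ((7 ^ c : ℕ) : 𝓞 (F a c))) ∈ v.asIdeal := v.asIdeal.mul_mem_right _ hθ
  have h2 := v.asIdeal.sub_mem h h1
  rw [add_sub_cancel_left] at h2
  exact h7 (v.isPrime.mem_of_pow_mem _ h2)

/-- `N₂ ∉ v` when `7 ∈ v`, `θ ∉ v` (`c ≥ 1`). [folklore] -/
theorem N₂_not_mem_of_not_mem (h7 : ((7 : ℕ) : 𝓞 (F a c)) ∈ v.asIdeal) (hθ : θI a c ∉ v.asIdeal) (hc : 1 ≤ c) :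
    θI a c ^ 2 - ((7 ^ c : ℕ) : 𝓞 (F a c)) * θI a c + ((7 ^ (2 * c) : ℕ) : 𝓞 (F a c)) ∉ v.asIdeal := by
  rw [N₂_eq]
  intro h
  have h7c : ((7 : ℕ) : 𝓞 (F a c)) ^ (2 * c) ∈ v.asIdeal := v.asIdeal.pow_mem_of_mem h7 (2 * c) (by omega)
  have h2 := v.asIdeal.sub_mem h h7c
  rw [add_sub_cancel_right] at h2
  rcases v.isPrime.mem_or_mem h2 with h3 | h3
  · exact hθ h3
  · exact N₁_not_mem' h7 hθ hc h3

/-- `ord_v N₂ = 0` when `N₂ ∉ v`, and `ord_v N₂ ≥ 0` always. [cite: DupuyHilado2025, §2.4.2] -/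
theorem ord_N₂_nonneg : 0 ≤ ord (F a c) v (θ a c ^ 2 - (7 : F a c) ^ c * θ a c + (7 : F a c) ^ (2 * c)) := by
  rw [← coe_N₂]; exact ord_nonneg_of_isIntegral (F a c) v _

/-- `ord_v N₂ = 0` when `N₂ ∉ v`. [cite: DupuyHilado2025, §2.4.2] -/
theorem ord_N₂_eq_zero (h : θI a c ^ 2 - ((7 ^ c : ℕ) : 𝓞 (F a c)) * θI a c + ((7 ^ (2 * c) : ℕ) : 𝓞 (F a c)) ∉ v.asIdeal) :
    ord (F a c) v (θ a c ^ 2 - (7 : F a c) ^ c * θ a c + (7 : F a c) ^ (2 * c)) = 0 := by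
  rw [← coe_N₂]; exact SplitDepth.ord_coe_eq_zero_of_not_mem v h

/-- At `𝔮₁` (`7 ∈ v`, `θ ∈ v ∌ θ'`, `ord_v 7 = 1`, `c ≥ 1`): `ord_v N₂ = 2c`. [cite: DupuyHilado2025, §2.4.2] -/
theorem ord_N₂_eq (h7 : ((7 : ℕ) : 𝓞 (F a c)) ∈ v.asIdeal) (hθ' : θI' a c ∉ v.asIdeal)
    (ho7 : ord (F a c) v (7 : F a c) = 1) (hc : 1 ≤ c) :
    ord (F a c) v (θ a c ^ 2 - (7 : F a c) ^ c * θ a c + (7 : F a c) ^ (2 * c)) = 2 * c := by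
  rw [← coe_N₂]
  set N₂ : 𝓞 (F a c) := θI a c ^ 2 - ((7 ^ c : ℕ) : 𝓞 (F a c)) * θI a c + ((7 ^ (2 * c) : ℕ) : 𝓞 (F a c)) with hN₂
  have h5 : ((5 : ℕ) : 𝓞 (F a c)) ∉ v.asIdeal :=
    SplitDepth.natCast_not_mem_of_prime_ne (p := 7) ⟨v, mem_placesOver_of_natCast_mem 7 v h7⟩ (by norm_num) (by norm_num)
  have ho5 : ord (F a c) v (5 : F a c) = 0 := by
    have := ord_natCast_eq_zero_of_not_mem v h5; simpa using this
  have hoθ : ord (F a c) v (θ a c) = c := by rw [ord_θ_of_not_mem hθ', ho5, ho7]; ring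
  have hoN₁ : ord (F a c) v (θ a c - (7 : F a c) ^ c) = 2 * c := ord_N₁_eq h7 hθ' ho7 hc
  have hθ0 : θI a c ≠ 0 := fun h => (θ_ne_zero a c).1 (by rw [← coe_θI, h]; rfl)
  have hN₁0 : θI a c - ((7 ^ c : ℕ) : 𝓞 (F a c)) ≠ 0 := fun h => (N₁_ne_zero a c).1 (by rw [← coe_N₁, h]; rfl)
  have h7c0 : ((7 ^ (2 * c) : ℕ) : 𝓞 (F a c)) ≠ 0 := by exact_mod_cast (by positivity : 7 ^ (2 * c) ≠ 0)
  have hprod_mem : θI a c * (θI a c - ((7 ^ c : ℕ) : 𝓞 (F a c))) ∈ v.asIdeal ^ (2 * c + 1) := by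
    apply mem_pow_of_le_ord v (mul_ne_zero hθ0 hN₁0)
    have e : ((θI a c * (θI a c - ((7 ^ c : ℕ) : 𝓞 (F a c))) : 𝓞 (F a c)) : F a c) = θ a c * (θ a c - (7 : F a c) ^ c) := by
      rw [RingOfIntegers.coe_eq_algebraMap, map_mul, ← RingOfIntegers.coe_eq_algebraMap, ← RingOfIntegers.coe_eq_algebraMap,
        coe_θI, coe_N₁]
    rw [e, ord_mul (F a c) v (θ_ne_zero a c).1 (N₁_ne_zero a c).1, hoθ, hoN₁]
    push_cast; omega
  have ho7c : ord (F a c) v (((7 ^ (2 * c) : ℕ) : 𝓞 (F a c)) : F a c) = 2 * c := by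
    rw [coe_natCast']; push_cast; rw [ord_pow, ho7]; push_cast; ring
  have h7c_mem : ((7 ^ (2 * c) : ℕ) : 𝓞 (F a c)) ∈ v.asIdeal ^ (2 * c) :=
    mem_pow_of_le_ord v h7c0 (by rw [ho7c]; push_cast; omega)
  have h7c_not : ((7 ^ (2 * c) : ℕ) : 𝓞 (F a c)) ∉ v.asIdeal ^ (2 * c + 1) := fun h => by
    have := SplitDepth.le_ord_coe_of_mem_pow v h7c0 h
    rw [ho7c] at this; push_cast at this; omega
  have hN₂eq : N₂ = θI a c * (θI a c - ((7 ^ c : ℕ) : 𝓞 (F a c))) + ((7 ^ (2 * c) : ℕ) : 𝓞 (F a c)) := by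
    rw [hN₂, N₂_eq]; push_cast; ring
  have hN₂_mem : N₂ ∈ v.asIdeal ^ (2 * c) := by
    rw [hN₂eq]
    exact Ideal.add_mem _ (Ideal.pow_le_pow_right (by omega) hprod_mem) h7c_mem
  have hN₂_not : N₂ ∉ v.asIdeal ^ (2 * c + 1) := fun h => h7c_not (by
    rw [hN₂eq] at h
    have := Ideal.sub_mem _ h hprod_mem
    rwa [add_sub_cancel_left] at this)
  have hN₂0 : N₂ ≠ 0 := fun h => hN₂_not (h ▸ Ideal.zero_mem _)
  have h1 := SplitDepth.le_ord_coe_of_mem_pow v hN₂0 hN₂_mem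
  have h2 : ¬ ((2 * c + 1 : ℕ) : ℤ) ≤ ord (F a c) v ((N₂ : 𝓞 (F a c)) : F a c) :=
    fun h => hN₂_not (mem_pow_of_le_ord v hN₂0 h)
  push_cast at h1 h2
  omega

end Ord

end Summit.ABC.IUTFork.SUnitFamily

end
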